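import Summits.CriticalPhenomena.CardyFormulaZ2.Theses.CardyBondTriangular
import Literature.Probability.Percolation.TriangularBoxCrossingGlue
import HarnessLib

/-!
# Route CardyBondTriangular — item `BondTriangularBoxCrossing` (stmt-CriticalPhenomena-7023): reductions

The body of the route item `BondTriangularBoxCrossing` — the box-crossing (RSW) property of
critical bond percolation on the triangular lattice `𝕋` (`bondPercolation triGraph
(criticalWeightI (π/6))`, `p = 2 sin(π/18)`) in the route's drawing
`z x = √3 · (triEmbed x − (1 + ζ)/3)` — is *literally equivalent* to the Literature named fact
`GrimmettManolescuAOP2013_triangular_boxCrossing` (Grimmett–Manolescu, Ann. Probab. 41 (2013),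
§1.3 Thm 3 (b), homogeneous case), by
`GrimmettManolescuAOP2013_triangular_boxCrossing_iff_route_normalisation`
(`TriangularBoxCrossingProofs`). This file records the equivalence and the resulting reductions
of the item to the catalogued isoradial facts `gm_boxCrossing` (for `𝕋 ∈ 𝒢`,
`triIsoradialEmbedding`) and `gm_boxCrossingBounds_uniform` (Grimmett–Manolescu 2014, Thm 1.1(a)
= §3 Thm 3.1), through `TriangularBoxCrossingGlue`.

These are CONDITIONAL results (hypotheses = unproved named facts); the unconditional proof of the
item is the subject of the companion files `CardyBondTriangularBondTriangularBoxCrossing*`.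
-/

namespace Summit.CriticalPhenomena.CardyFormulaZ2.Theorems

open Literature.Probability.LatticeModels Literature.Probability.Percolation

/-- **The item is the Literature fact, verbatim up to normalisation**: the route item
`BondTriangularBoxCrossing` holds iff `GrimmettManolescuAOP2013_triangular_boxCrossing`
(critical bond-`𝕋` has the box-crossing property in every drawing `s • triEmbed`, `0 < s ≤ 2`)
holds. (Grimmett–Manolescu 2013, §1.3: the box-crossing property is invariant under affine maps;
tree: `GrimmettManolescuAOP2013_triangular_boxCrossing_iff_route_normalisation`.) -/
theorem bondTriangularBoxCrossing_iff_GM2013 :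
    Summit.CriticalPhenomena.CardyFormulaZ2.Theses.CardyBondTriangular.BondTriangularBoxCrossing ↔
      GrimmettManolescuAOP2013_triangular_boxCrossing := by
  unfold Summit.CriticalPhenomena.CardyFormulaZ2.Theses.CardyBondTriangular.BondTriangularBoxCrossing
  exact GrimmettManolescuAOP2013_triangular_boxCrossing_iff_route_normalisation.symm

/-- **Reduction 1**: the item from the named fact `GrimmettManolescuAOP2013_triangular_boxCrossing`
(Grimmett–Manolescu 2013, §1.3 Thm 3 (b), homogeneous triangular case). -/
theorem bondTriangularBoxCrossing_of_GM2013 (h : GrimmettManolescuAOP2013_triangular_boxCrossing) :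
    Summit.CriticalPhenomena.CardyFormulaZ2.Theses.CardyBondTriangular.BondTriangularBoxCrossing :=
  bondTriangularBoxCrossing_iff_GM2013.2 h

/-- **Reduction 2**: the item from the isoradial box-crossing fact `gm_boxCrossing` for the
isoradial triangular lattice `triIsoradialEmbedding` (Grimmett–Manolescu 2014, §3 Thm 3.1 for
`𝕋 ∈ 𝒢`; every structural hypothesis of `𝒢` is discharged in `TriangularBoxCrossingGlue`). -/
theorem bondTriangularBoxCrossing_of_gm_boxCrossing
    (h : gm_boxCrossing triGraph triIsoradialEmbedding (Real.pi / 6)) :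
    Summit.CriticalPhenomena.CardyFormulaZ2.Theses.CardyBondTriangular.BondTriangularBoxCrossing :=
  bondTriangularBoxCrossing_of_GM2013
    (GrimmettManolescuAOP2013_triangular_boxCrossing_of_gm_boxCrossing_triangular h)

/-- **Reduction 3**: the item from the uniform isoradial box-crossing fact
`gm_boxCrossingBounds_uniform` (Grimmett–Manolescu 2014, (3.1)). -/
theorem bondTriangularBoxCrossing_of_gm_boxCrossingBounds_uniform (h : gm_boxCrossingBounds_uniform) :
    Summit.CriticalPhenomena.CardyFormulaZ2.Theses.CardyBondTriangular.BondTriangularBoxCrossing :=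
  bondTriangularBoxCrossing_of_GM2013
    (GrimmettManolescuAOP2013_triangular_boxCrossing_of_gm_boxCrossingBounds_uniform h)

end Summit.CriticalPhenomena.CardyFormulaZ2.Theorems
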